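import Literature.Computability.QuantumComplexity.RazTalBlocks
import Literature.Computability.QuantumComplexity.ForrelationThm25Amplitude
import HarnessLib

/-!
# Fourier sampling around a basis-state map: the `H–D–H` sandwich on a sub-register

Topic `Literature/Computability/QuantumComplexity`; first file of the `BQP^O` machine for Simon's
algorithm on the level encoding of the `P/poly`-oracle separation (Aaronson–Chen 2017, Thm. 7.6,
Servedio–Gortler variant; the hypothesis `SimonLevelMachine` of
`Literature/Barriers/QuantumAdvantage/PPolyOraclesThm76Simon.lean`). Simon's subroutine
Fourier-twice (Simon 1997, §3.1) in the XOR-oracle-gate model is `H^{⊗Y}` on the query register,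
a segment `D` of CLASSICAL reversible gates and oracle gates mapping basis states to basis states
without touching the query register (`|y, rest⟩ ↦ |y, rest ⊕ f-data(y)⟩`), and `H^{⊗Y}` again.
This file proves the generic linear algebra of such sandwiches on an embedded sub-register
(tools: `hLayerE`/`toMatrix_hLayerE`/`placeGate_mulVec_basisState` of `RazTalBlocks.lean`):

* `hLayerE_mulVec_basisState_extend` — `H^{⊗Y}` on the sub-register `e` of a basis state:
  `|e ↦ u, rest⟩ ↦ ∑_ξ H^{⊗Y}(ξ, u) |e ↦ ξ, rest⟩`;
* `sandwich_mulVec` — for a segment `D` with `D |e ↦ u, w₀⟩ = |σ u⟩`: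
  `(H_e · D · H_e) |e ↦ u₀, w₀⟩ = ∑_u ∑_ξ H(u, u₀) H(ξ, σ u ∘ e) |e ↦ ξ, σ u⟩`;
* `sandwich_mulVec_apply` — the amplitude at a basis label `x`:
  `∑_u [σ u = x off e] · H(u, u₀) · H(x ∘ e, σ u ∘ e)` (Simon's "Fourier-twice" amplitude when
  `σ u` writes `f(u)` on the value register: `2^{-Y} ∑_{u : f u = value(x)} (−1)^{u·ξ}`).

## References

* D. R. Simon, *On the power of quantum computation*, SIAM J. Comput. 26 (1997), §3.1 [Simon1997].
* M. A. Nielsen, I. L. Chuang, *Quantum Computation and Quantum Information*, CUP 2010, §1.4.4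
  eq. (1.50) (`H^{⊗n}`), §6.1.1 (the oracle) [NielsenChuang2010].
-/

noncomputable section

namespace Literature.Computability.QuantumComplexity

open Matrix _root_.Computability Complexity Cryptography Finset RazTalMachine

namespace SimonOracle

variable {N Y : ℕ}

/-! ### Overwriting a sub-register -/

/-- Overwriting twice along `e` keeps the last value. [folklore] -/
theorem extend_extend (e : Fin Y ↪ Fin N) (ξ u : QReg Y) (w : QReg N) :
    Function.extend e ξ (Function.extend e u w) = Function.extend e ξ w := by
  funext i
  by_cases hi : i ∈ Set.range e
  · obtain ⟨j, rfl⟩ := hi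
    rw [e.injective.extend_apply, e.injective.extend_apply]
  · rw [extend_apply_of_not_mem e _ _ hi, extend_apply_of_not_mem e _ _ hi, extend_apply_of_not_mem e _ _ hi]

/-- Overwriting a register along `e` with its own contents does nothing. [folklore] -/
theorem extend_comp_self (e : Fin Y ↪ Fin N) (w : QReg N) : Function.extend e (w ∘ e) w = w := by
  funext i
  by_cases hi : i ∈ Set.range e
  · obtain ⟨j, rfl⟩ := hi
    rw [e.injective.extend_apply]; rfl
  · rw [extend_apply_of_not_mem e _ _ hi]

/-- `e ↦ ξ` on `w` equals `x` iff `ξ = x ∘ e` and `w = x` off `e`. [folklore] -/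
theorem extend_eq_iff (e : Fin Y ↪ Fin N) (ξ : QReg Y) (w x : QReg N) :
    Function.extend e ξ w = x ↔ ξ = x ∘ e ∧ ∀ i, i ∉ Set.range e → w i = x i := by
  constructor
  · intro h
    refine ⟨?_, fun i hi => ?_⟩
    · rw [← h, extend_comp_embedding]
    · rw [← h, extend_apply_of_not_mem e _ _ hi]
  · rintro ⟨rfl, h⟩
    funext i
    by_cases hi : i ∈ Set.range e
    · obtain ⟨j, rfl⟩ := hi
      exact e.injective.extend_apply _ _ j
    · rw [extend_apply_of_not_mem e _ _ hi, h i hi]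

/-! ### The Hadamard layer on a sub-register of a basis state -/

/-- **`H^{⊗Y}` on the sub-register `e` of a basis state**:
`H_e |e ↦ u, w⟩ = ∑_ξ H^{⊗Y}(ξ, u) |e ↦ ξ, w⟩`. [cite: NielsenChuang2010, §1.4.4 eq. (1.50)] -/
theorem hLayerE_mulVec_basisState_extend (A : Language Bool) (e : Fin Y ↪ Fin N) (u : QReg Y) (w : QReg N) :
    (⟨hLayerE e⟩ : QCircuit cliffordT N).toMatrix A *ᵥ basisState (Function.extend e u w) =
      ∑ ξ : QReg Y, hGateAll Y ξ u • basisState (Function.extend e ξ w) := by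
  rw [toMatrix_hLayerE, placeGate_mulVec_basisState]
  refine Finset.sum_congr rfl fun ξ _ => ?_
  rw [extend_comp_embedding, extend_extend]

/-- The same on an arbitrary basis state, read through its own sub-register. [cite: NielsenChuang2010, §1.4.4] -/
theorem hLayerE_mulVec_basisState (A : Language Bool) (e : Fin Y ↪ Fin N) (w : QReg N) :
    (⟨hLayerE e⟩ : QCircuit cliffordT N).toMatrix A *ᵥ basisState w =
      ∑ ξ : QReg Y, hGateAll Y ξ (w ∘ e) • basisState (Function.extend e ξ w) := by
  conv_lhs => rw [← extend_comp_self e w]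
  exact hLayerE_mulVec_basisState_extend A e (w ∘ e) w

/-! ### The sandwich `H_e · D · H_e` -/

/-- **The `H–D–H` sandwich on a basis state.** If the segment `D` maps `|e ↦ u, w₀⟩` to the basis
state `|σ u⟩` for every content `u` of the sub-register, then
`(H_e; D; H_e) |e ↦ u₀, w₀⟩ = ∑_u ∑_ξ H(u, u₀) H(ξ, σ u ∘ e) |e ↦ ξ, σ u⟩`.
[cite: Simon1997, §3.1 (Fourier-twice)] [cite: NielsenChuang2010, §1.4.4] -/
theorem sandwich_mulVec (A : Language Bool) (e : Fin Y ↪ Fin N) (w₀ : QReg N) (D : List (QGate cliffordT N))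
    (σ : QReg Y → QReg N)
    (hD : ∀ u : QReg Y, (⟨D⟩ : QCircuit cliffordT N).toMatrix A *ᵥ basisState (Function.extend e u w₀) = basisState (σ u))
    (u₀ : QReg Y) :
    (⟨hLayerE e ++ (D ++ hLayerE e)⟩ : QCircuit cliffordT N).toMatrix A *ᵥ basisState (Function.extend e u₀ w₀) =
      ∑ u : QReg Y, ∑ ξ : QReg Y,
        (hGateAll Y u u₀ * hGateAll Y ξ (σ u ∘ e)) • basisState (Function.extend e ξ (σ u)) := by
  rw [toMatrix_mk_append, toMatrix_mk_append, ← Matrix.mulVec_mulVec, ← Matrix.mulVec_mulVec,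
    hLayerE_mulVec_basisState_extend, Matrix.mulVec_sum, Matrix.mulVec_sum]
  refine Finset.sum_congr rfl fun u _ => ?_
  rw [Matrix.mulVec_smul, Matrix.mulVec_smul, hD u, hLayerE_mulVec_basisState, Finset.smul_sum]
  refine Finset.sum_congr rfl fun ξ _ => ?_
  rw [smul_smul]

/-- **The amplitudes of the sandwich**: at the basis label `x`,
`∑_u [σ u = x off e] · H(u, u₀) · H(x ∘ e, σ u ∘ e)`. [cite: Simon1997, §3.1] -/
theorem sandwich_mulVec_apply (A : Language Bool) (e : Fin Y ↪ Fin N) (w₀ : QReg N) (D : List (QGate cliffordT N))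
    (σ : QReg Y → QReg N)
    (hD : ∀ u : QReg Y, (⟨D⟩ : QCircuit cliffordT N).toMatrix A *ᵥ basisState (Function.extend e u w₀) = basisState (σ u))
    (u₀ : QReg Y) (x : QReg N) :
    ((⟨hLayerE e ++ (D ++ hLayerE e)⟩ : QCircuit cliffordT N).toMatrix A *ᵥ basisState (Function.extend e u₀ w₀)) x =
      ∑ u : QReg Y, if (∀ i, i ∉ Set.range e → σ u i = x i) then
        hGateAll Y u u₀ * hGateAll Y (x ∘ e) (σ u ∘ e) else 0 := by
  classical
  rw [sandwich_mulVec A e w₀ D σ hD u₀]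
  simp only [Finset.sum_apply, Pi.smul_apply, basisState_apply, smul_eq_mul, mul_ite, mul_one, mul_zero]
  refine Finset.sum_congr rfl fun u _ => ?_
  have key : ∀ ξ : QReg Y, (x = Function.extend e ξ (σ u)) ↔ (ξ = x ∘ e ∧ ∀ i, i ∉ Set.range e → σ u i = x i) := by
    intro ξ
    rw [eq_comm, extend_eq_iff]
  simp_rw [key]
  by_cases hag : ∀ i, i ∉ Set.range e → σ u i = x i
  · have hag' : (∀ i, i ∉ Set.range e → σ u i = x i) ↔ True := iff_true_intro hag
    simp only [hag', and_true, Finset.sum_ite_eq', Finset.mem_univ, if_true]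
  · have hag' : (∀ i, i ∉ Set.range e → σ u i = x i) ↔ False := iff_false_intro hag
    simp only [hag', and_false, if_false, Finset.sum_const_zero]

/-! ### The Simon shape: the segment writes a function of the query register on a value register -/

section Value

variable {V : ℕ}

/-- The basis label after a segment that writes `F u` on the value register `eV` and leaves the
rest of `|e ↦ u, w₀⟩` alone. [cite: Simon1997, §3.1] -/
def valueState (e : Fin Y ↪ Fin N) (eV : Fin V ↪ Fin N) (w₀ : QReg N) (F : QReg Y → QReg V) (u : QReg Y) : QReg N :=
  Function.extend eV (F u) (Function.extend e u w₀)

variable {e : Fin Y ↪ Fin N} {eV : Fin V ↪ Fin N}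

/-- The query register of the value state is `u` (the two registers are disjoint). [folklore] -/
theorem valueState_comp_e (hdis : ∀ i j, e i ≠ eV j) (w₀ : QReg N) (F : QReg Y → QReg V) (u : QReg Y) :
    valueState e eV w₀ F u ∘ e = u := by
  funext j
  simp only [Function.comp_apply, valueState]
  rw [extend_apply_of_not_mem eV _ _ (by rintro ⟨i, hi⟩; exact hdis j i hi.symm), e.injective.extend_apply]

/-- The value register of the value state is `F u`. [folklore] -/
theorem valueState_eV (w₀ : QReg N) (F : QReg Y → QReg V) (u : QReg Y) (j : Fin V) :
    valueState e eV w₀ F u (eV j) = F u j := by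
  simp only [valueState]
  rw [eV.injective.extend_apply]

/-- Off both registers the value state is `w₀`. [folklore] -/
theorem valueState_of_not_mem (w₀ : QReg N) (F : QReg Y → QReg V) (u : QReg Y) {i : Fin N}
    (hi : i ∉ Set.range e) (hi' : i ∉ Set.range eV) : valueState e eV w₀ F u i = w₀ i := by
  simp only [valueState]
  rw [extend_apply_of_not_mem eV _ _ hi', extend_apply_of_not_mem e _ _ hi]

/-- Agreement of the value state with `x` off the query register: the value register of `x` reads
`F u` and `x = w₀` off both registers. [folklore] -/
theorem valueState_agree_iff (hdis : ∀ i j, e i ≠ eV j) (w₀ : QReg N) (F : QReg Y → QReg V) (u : QReg Y) (x : QReg N) :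
    (∀ i, i ∉ Set.range e → valueState e eV w₀ F u i = x i) ↔
      F u = x ∘ eV ∧ ∀ i, i ∉ Set.range e → i ∉ Set.range eV → w₀ i = x i := by
  constructor
  · intro h
    refine ⟨funext fun j => ?_, fun i hi hi' => ?_⟩
    · have := h (eV j) (by rintro ⟨i, hi⟩; exact hdis i j hi)
      rwa [valueState_eV] at this
    · rw [← valueState_of_not_mem w₀ F u hi hi']
      exact h i hi
  · rintro ⟨hF, hw⟩ i hi
    by_cases hi' : i ∈ Set.range eV
    · obtain ⟨j, rfl⟩ := hi'
      rw [valueState_eV, hF]; rfl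
    · rw [valueState_of_not_mem w₀ F u hi hi', hw i hi hi']

/-- **Simon's Fourier-twice amplitudes.** If the segment `D` writes `F u` on the value register
(`D |e ↦ u, w₀⟩ = |valueState u⟩`), then the amplitude of `(H_e; D; H_e) |e ↦ u₀, w₀⟩` at `x` is
`∑_{u : F u = x|_{eV}} H(u, u₀) H(x|_e, u)` if `x = w₀` off the two registers, and `0` otherwise —
for `u₀ = 0`: `2^{-Y} ∑_{u : F u = x|_{eV}} (−1)^{x|_e · u}`. [cite: Simon1997, §3.1 (the amplitude of `|ξ⟩|f(y)⟩`)] -/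
theorem sandwich_value_apply (A : Language Bool) (hdis : ∀ i j, e i ≠ eV j) (w₀ : QReg N)
    (F : QReg Y → QReg V) (D : List (QGate cliffordT N))
    (hD : ∀ u : QReg Y, (⟨D⟩ : QCircuit cliffordT N).toMatrix A *ᵥ basisState (Function.extend e u w₀) =
      basisState (valueState e eV w₀ F u))
    (u₀ : QReg Y) (x : QReg N) :
    ((⟨hLayerE e ++ (D ++ hLayerE e)⟩ : QCircuit cliffordT N).toMatrix A *ᵥ basisState (Function.extend e u₀ w₀)) x =
      if (∀ i, i ∉ Set.range e → i ∉ Set.range eV → w₀ i = x i) then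
        ∑ u : QReg Y, (if F u = x ∘ eV then hGateAll Y u u₀ * hGateAll Y (x ∘ e) u else 0)
      else 0 := by
  classical
  rw [sandwich_mulVec_apply A e w₀ D _ hD u₀ x]
  simp_rw [valueState_agree_iff hdis, valueState_comp_e hdis]
  split_ifs with hw
  · refine Finset.sum_congr rfl fun u _ => ?_
    have hw' : (∀ i, i ∉ Set.range e → i ∉ Set.range eV → w₀ i = x i) ↔ True := iff_true_intro hw
    simp only [hw', and_true]
  · refine Finset.sum_eq_zero fun u _ => ?_
    rw [if_neg (fun h => hw h.2)]

end Value

end SimonOracle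

end Literature.Computability.QuantumComplexity

end
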